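import Literature.MathematicalPhysics.QuantumFieldTheory.Balaban1983to89.T4ShellMeasureSocket

/-!
# T4ShellMeasureLevels — node U5b/U5.E, cell input NE7c = `T4IndicatorShell.ShellWeightBound`: the LEVEL LEDGER of
a run (shell-measure route, SMOOTH members (γ″)/(γ‴)), its geometric relative shell weight, and the passage through the
seam-(ζ′) socket WITHOUT any choice-function binder

(cell `pub-balaban`, T4-DAG v23 §6 row NE7c, fan-out seat `b2b-balaban-t4-ne7c-p1` gen 9, design row
T4-U5b.E2-NE7c-PROVE-P1k*; imports `T4ShellMeasureSocket` ONLY (hence `T4ShellMeasure` + `T4MatchingClosureSocket`);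
companion record `t4/T4-EST-NE7c-P1.md` §5; KERNEL BOOKKEEPING ONLY: 0 estimates, every located input a binder.)

HONEST FRAMING (T4-DAG PAGE 1).  Rung (B)+1 scoping of the T⁴-continuum cell: existence and uniqueness of the `ε → 0`
limit of unit-scale averaged expectations on a FIXED finite torus — NOT infinite volume, NOT a mass gap, NOT Clay, and
NOT a proof of NE7c.  Nothing of the run-A/run-B comparison is printed in [Balaban 1983–89] (the manuscripts construct
ONE run); nothing printed is asserted here and no constant of Bałaban's is chosen.  Every conditional of the cell
(BetaPertH, (B), (B^μ)) stays where it is — upstream of the term families, untouched.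

WHY THIS LEAF.  The smooth members of the shell-measure route end, per SLOT `s` of a run at comparison `K` and source
`t`, in the slot-ledger field
  `Σ_τ piece K t s τ ≤ (D · ρ) · Σ_τ A K t τ`
with `D ρ` the slot's anti-concentration constant and relative shell width
(`T4ShellMeasure.slot_field_of_antiConcentration` reached BY NAME by `T4ShellMeasurePolar.slot_field_of_logPolar` /
`_density` / `_cotest` — there `D = 2·fibreCoef δ B ℓ₀ L·M` — and by `T4ShellMeasureTwoSpeed.slot_field_of_logPolar₂` /
`_density₂` / `_cotest₂` for the toron band), the whole point of the route being that `D = D_j` and `ρ = ρ_j` depend on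
the slot's LEVEL `j = lvl K s` ONLY, not on `K` (record §0(d): ‹K-INDEPENDENT constant›).  From there to the NE7c socket
datum three pieces of landed arithmetic had to be composed BY THE CONSUMER: the slot ledger
(`T4ShellMeasure.SlotLedger`, §4 there), the count by levels (`sum_slots_le_sum_levels`, §2) and the window arithmetic
(`levelSum_le_geometric`, §3), under three located inputs that were only WORDS in the record: the bounded live window
(W1), the slot count per level `ν̄`, and the (F∞)-rate `ρ_j ≤ c₁ϑ^j`.  This leaf TYPES the three as binders and composes
once, so that the smooth members' output is LITERALLY `T4IndicatorShell.ShellWeightBound` and, through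
`T4MatchingClosureSocket.hybridNE7_closure'_tail`, a `T4MatchingAssembly.HybridNE7` datum — with ONE `RelWeightBound`
and ONE `ReindexedBudget`: since the smooth members keep the PRINTED thresholds, NO threshold convention is chosen, so
neither the `∀ choice-function` form (L1-step) of the NE7b half and of the budget nor the threshold-free dictionary
(L2b) for every candidate expansion is asked — contrast the threshold-averaging member (δ)
(`T4ShellMeasureSocket.hybridNE7_tail_of_liveFactor`, whose binder list carries both).

WHAT THIS LEAF DOES.
* §1 `LevelLedger l₀ T A sh S piece lvl D ρ` (a `Prop` structure = hypothesis shape for ONE run): the three expansion-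
  structure fields of `SlotLedger` [(R): `0 ≤ sh ≤ A`, shell parts covered by per-slot pieces] + the per-slot field with
  constant `D (lvl K s) * ρ (lvl K s)` [(M1) by level = the smooth members' outputs, each with its own binders] +
  `0 ≤ D`, `0 ≤ ρ`; `LevelLedger.toSlotLedger`; `LiveWindow S lvl N₁ νbar` [(W1): `K ≤ lvl K s + N₁` and `lvl K s ≤ K`;
  `ν̄`: at most `νbar` slots per level]; `LevelLedger.omega_le`: the run's relative shell weight
  `ω K = Σ_{s ∈ S K} D_{lvl s} ρ_{lvl s} ≤ ((N₁ + 1)·ν̄·D̄·c₁·ϑ^{−N₁})·ϑ^K` under `D ≤ D̄` and the rate `ρ_j ≤ c₁ϑ^j`,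
  `0 < ϑ ≤ 1` (the signs `0 ≤ c₁`, `0 ≤ D̄`, `0 ≤ ν̄` are CONSEQUENCES, `rate_const_nonneg` etc.).
* §2 `shellWeightBound_of_levels`: two level ledgers (the two runs of comparison `K`; own levels, constants, widths;
  common bounds `N₁ ν̄ D̄ c₁ ϑ`, `0 < ϑ < 1`) ⇒ `T4IndicatorShell.ShellWeightBound l₀ T A B shA shB (ω^A + ω^B)`
  (= `T4ShellMeasure.shellWeightBound_of_slotLedger` with its two majorant binders DISCHARGED by §1); `omega_add_le`
  (the explicit geometric bound `2·((N₁ + 1)ν̄D̄c₁ϑ^{−N₁})·ϑ^K`) and `eventually_omega_add_lt`.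
* §3 `hybridNE7_tail_of_levels` = §2 ∘ `T4MatchingClosureSocket.hybridNE7_closure'_tail`: PLUS one NE7b half
  `RelWeightBound`, one `ReindexedBudget` on the hybrid cores `A − shA`, `B − shB` and four summable rates ⇒
  `∃ K₀`, a `HybridNE7` datum for the `K₀`-shifted families with shell weight `ω^A + ω^B`; and per string of a torus
  scheme `stringHybridNE7_of_levels` = §2 ∘ `stringHybridNE7_closure'_tail` (E1/E2 dictionary for the ONE expansion
  with the printed thresholds) ⇒ `∃ K₁, StringHybridNE7 S os l₀ vol (K₀ + K₁)`, the per-string hypothesis of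
  `T4MatchingClosureHosts.hasContinuumLimit_of_stringClosures`.
* §4 the rate binder in the shape the U1b liaison produces: with `ρ j := c / θmin * ϑ ^ j` (the `geomWidth` of
  `T4SupCloseLiaison`, NOT imported — other lineage; same closed form) the rate field holds with `c₁ = c/θmin` by
  `le_rfl` (`rate_of_geomWidth_shape`), so a seat holding U1b's `LocalRate` reading feeds §1–§3 with that `ρ`.
* §5 non-vacuity (kernel-checked, honest scope): the no-slot ledger and window (`levelLedger_noSlots`,
  `liveWindow_noSlots`), §3 firing on the trivial datum of `T4MatchingAssembly.hybridNE7_trivial`; and a ONE-SLOT toy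
  with a genuinely level-dependent width (`Toy.levelLedger`, slot at the top level, `ρ_j = ϑ^j`, `ω K = ϑ^K` exactly) on
  which §1's bound is attained (window depth `0`).

LOCATED, NOT PRINTED, NOT DISCHARGED HERE (they are the binder blocks; record §3–§4, GAPS G-ne7cp1-*): (R) the reading
of the expansion B14 (2.18) as a sum of nonnegative terms with per-slot shell pieces — fields `sh_nonneg sh_le cover`;
(M1) per level — field `slot`, i.e. the smooth members with THEIR binders ((AN-bound) at bond level G-ne7cp1-14, (SM)
G-ne7cp1-9, (DC-fwd) G-ne7cp1-10/10a/10b, (SS′) mass ratio G-ne7cp1-7/7a, chart + centre (TS)/(GOOD′) G-ne7cp1-11/13a);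
(W1) the bounded live window — `LiveWindow.recent` (G-ne7cp1-4: background-mediated slots whose two-run values can
straddle a threshold live only at levels `K − N₁ ≤ j ≤ K`); `ν̄` — `LiveWindow.count` (on the unit torus the number of
level-`j` cubes inside the window is at most `v₀Λ^{N₁}`, `Λ = L⁴`: torus geometry, COUNTED not estimated, still a binder
here); (F∞)-rate — `hrate` (NE3 species, node U1b; GAPS G-pv07-6/6′, `T4SupCloseLiaison`).  NOT summit progress.

ABSOLUTE RULE.  No internally-minted statement is a cited fact; every hypothesis is a binder; nothing of
[Balaban 1983–89] is instantiated or quoted as authority for a disputed step; all docstrings [folklore]; 0 sorry.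
-/

open Finset

namespace Literature.MathematicalPhysics.QuantumFieldTheory.Balaban1983to89.T4ShellMeasureLevels

open Literature.MathematicalPhysics.QuantumFieldTheory.Balaban1983to89
open T4WeightBudget T4IndicatorShell T4MatchingAssembly T4MatchingClosure T4MatchingClosureSocket T4ShellMeasure

/-! ## §1 The level ledger of one run and its geometric relative shell weight -/

/-- **LEVEL LEDGER** (hypothesis shape for ONE run; cf. `T4ShellMeasure.SlotLedger`).  Terms `T K` with weights
`A K t τ` and shell parts `sh K t τ` on `|t| ≤ l₀`; slots `S K`, slot `s` sitting at LEVEL `lvl K s`; per-slot pieces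
`piece K t s τ` covering the shell parts [(R)]; and the per-slot anti-concentration field with a constant
`D (lvl K s) * ρ (lvl K s)` depending on the slot's LEVEL ONLY [(M1) by level — the output of
`T4ShellMeasure.slot_field_of_antiConcentration` / `T4ShellMeasurePolar.slot_field_of_logPolar` /
`T4ShellMeasureTwoSpeed.slot_field_of_logPolar₂` for that slot, `D_j = 2·fibreCoef δ_j B_j ℓ₀ L_j·M_j`], `0 ≤ D`,
`0 ≤ ρ`.  NOT PRINTED, NOT asserted. [folklore] -/
structure LevelLedger {ι σ : Type*} (l₀ : ℝ) (T : ℕ → Finset ι) (A sh : ℕ → ℝ → ι → ℝ) (S : ℕ → Finset σ)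
    (piece : ℕ → ℝ → σ → ι → ℝ) (lvl : ℕ → σ → ℕ) (D ρ : ℕ → ℝ) : Prop where
  /-- shell parts are nonnegative -/
  sh_nonneg : ∀ K t, |t| ≤ l₀ → ∀ τ ∈ T K, 0 ≤ sh K t τ
  /-- the shell part of a term never exceeds the term -/
  sh_le : ∀ K t, |t| ≤ l₀ → ∀ τ ∈ T K, sh K t τ ≤ A K t τ
  /-- every term's shell part is covered by its per-slot pieces -/
  cover : ∀ K t, |t| ≤ l₀ → ∀ τ ∈ T K, sh K t τ ≤ ∑ s ∈ S K, piece K t s τ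
  /-- per slot, the pieces weigh at most `D_{lvl s} ρ_{lvl s} ×` the total weight (anti-concentration BY LEVEL) -/
  slot : ∀ K t, |t| ≤ l₀ → ∀ s ∈ S K,
    ∑ τ ∈ T K, piece K t s τ ≤ (D (lvl K s) * ρ (lvl K s)) * ∑ τ ∈ T K, A K t τ
  /-- the level constants are nonnegative -/
  D_nonneg : ∀ j, 0 ≤ D j
  /-- the level widths are nonnegative -/
  ρ_nonneg : ∀ j, 0 ≤ ρ j

/-- **LIVE WINDOW AND SLOT COUNT** (hypothesis shape): every slot of comparison `K` sits at a level `j` with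
`K − N₁ ≤ j ≤ K` [(W1), `recent` and `le_top`], and at most `νbar` slots sit at any one level [`ν̄`, `count`].
NOT PRINTED, NOT asserted. [folklore] -/
structure LiveWindow {σ : Type*} (S : ℕ → Finset σ) (lvl : ℕ → σ → ℕ) (N₁ : ℕ) (νbar : ℝ) : Prop where
  /-- (W1): live slots are at most `N₁` levels below the top -/
  recent : ∀ K, ∀ s ∈ S K, K ≤ lvl K s + N₁
  /-- levels do not exceed the number of steps -/
  le_top : ∀ K, ∀ s ∈ S K, lvl K s ≤ K
  /-- at most `νbar` slots per level -/
  count : ∀ K j, (((S K).filter fun s => lvl K s = j).card : ℝ) ≤ νbar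

namespace LiveWindow

variable {σ : Type*} {S : ℕ → Finset σ} {lvl : ℕ → σ → ℕ} {N₁ : ℕ} {νbar : ℝ}

/-- the slot-count bound is nonnegative (a CONSEQUENCE of `count`). [folklore] -/
theorem νbar_nonneg (h : LiveWindow S lvl N₁ νbar) : 0 ≤ νbar :=
  (Nat.cast_nonneg _).trans (h.count 0 0)

/-- the levels of the live slots lie in the window `Icc (K − N₁) K`. [folklore] -/
theorem mem_Icc (h : LiveWindow S lvl N₁ νbar) (K : ℕ) {s : σ} (hs : s ∈ S K) :
    lvl K s ∈ Icc (K - N₁) K :=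
  Finset.mem_Icc.2 ⟨Nat.sub_le_iff_le_add.2 (h.recent K s hs), h.le_top K s hs⟩

/-- a larger window / a larger count bound is still a window. [folklore] -/
theorem mono (h : LiveWindow S lvl N₁ νbar) {N₁' : ℕ} {νbar' : ℝ} (hN : N₁ ≤ N₁') (hν : νbar ≤ νbar') :
    LiveWindow S lvl N₁' νbar' where
  recent K s hs := (h.recent K s hs).trans (by omega)
  le_top := h.le_top
  count K j := (h.count K j).trans hν

end LiveWindow

/-- the window `Icc (K − N₁) K` has at most `N₁ + 1` levels. [folklore] -/
theorem card_Icc_sub_le (K N₁ : ℕ) : ((Icc (K - N₁) K).card : ℝ) ≤ N₁ + 1 := by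
  have h : (Icc (K - N₁) K).card ≤ N₁ + 1 := by rw [Nat.card_Icc]; omega
  exact_mod_cast h

/-- every level of the window satisfies (W1) `K ≤ j + N₁`. [folklore] -/
theorem le_add_of_mem_Icc_sub {K N₁ j : ℕ} (hj : j ∈ Icc (K - N₁) K) : K ≤ j + N₁ :=
  Nat.sub_le_iff_le_add.1 (Finset.mem_Icc.1 hj).1

namespace LevelLedger

variable {ι σ : Type*} {l₀ : ℝ} {T : ℕ → Finset ι} {A sh : ℕ → ℝ → ι → ℝ} {S : ℕ → Finset σ}
  {piece : ℕ → ℝ → σ → ι → ℝ} {lvl : ℕ → σ → ℕ} {D ρ : ℕ → ℝ}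

/-- a level ledger IS a slot ledger with per-slot constant `c K s = D (lvl K s) * ρ (lvl K s)`. [folklore] -/
theorem toSlotLedger (h : LevelLedger l₀ T A sh S piece lvl D ρ) :
    SlotLedger l₀ T A sh S piece (fun K s => D (lvl K s) * ρ (lvl K s)) where
  sh_nonneg := h.sh_nonneg
  sh_le := h.sh_le
  cover := h.cover
  slot := h.slot
  c_nonneg _ _ _ := mul_nonneg (h.D_nonneg _) (h.ρ_nonneg _)

/-- the relative shell weight of a level ledger: `ω K = Σ_{s ∈ S K} D_{lvl s} ρ_{lvl s}`. [folklore] -/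
theorem omega_eq (h : LevelLedger l₀ T A sh S piece lvl D ρ) (K : ℕ) :
    h.toSlotLedger.omega K = ∑ s ∈ S K, D (lvl K s) * ρ (lvl K s) := rfl

/-- a rate `ρ_j ≤ c₁ϑ^j` for a nonnegative width forces `0 ≤ c₁` (read at `j = 0`). [folklore] -/
theorem rate_const_nonneg (h : LevelLedger l₀ T A sh S piece lvl D ρ) {c₁ ϑ : ℝ} (hrate : ∀ j, ρ j ≤ c₁ * ϑ ^ j) :
    0 ≤ c₁ := by
  have h0 := hrate 0
  rw [pow_zero, mul_one] at h0
  exact (h.ρ_nonneg 0).trans h0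

/-- a bound `D_j ≤ D̄` for a nonnegative constant forces `0 ≤ D̄`. [folklore] -/
theorem const_bound_nonneg (h : LevelLedger l₀ T A sh S piece lvl D ρ) {Dbar : ℝ} (hD : ∀ j, D j ≤ Dbar) :
    0 ≤ Dbar :=
  (h.D_nonneg 0).trans (hD 0)

/-- counting by levels inside the window: `ω K ≤ Σ_{j ∈ Icc (K − N₁) K} ν̄ · (D_j ρ_j)`
(`T4ShellMeasure.sum_slots_le_sum_levels`). [folklore] -/
theorem omega_le_levelSum (h : LevelLedger l₀ T A sh S piece lvl D ρ) {N₁ : ℕ} {νbar : ℝ}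
    (hw : LiveWindow S lvl N₁ νbar) (K : ℕ) :
    h.toSlotLedger.omega K ≤ ∑ j ∈ Icc (K - N₁) K, νbar * (D j * ρ j) := by
  rw [h.omega_eq]
  exact sum_slots_le_sum_levels (S K) (Icc (K - N₁) K) (lvl K) (fun j => D j * ρ j) (fun _ => νbar)
    (fun s hs => hw.mem_Icc K hs) (fun j _ => mul_nonneg (h.D_nonneg j) (h.ρ_nonneg j)) (fun j _ => hw.count K j)

/-- **THE RELATIVE SHELL WEIGHT OF A LEVEL LEDGER IS GEOMETRIC IN `K`.**  Window (W1) + count `ν̄` + `D_j ≤ D̄` + the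
(F∞)-rate `ρ_j ≤ c₁ϑ^j` with `0 < ϑ ≤ 1` ⇒ `ω K ≤ ((N₁ + 1)·ν̄·D̄·c₁·ϑ^{−N₁})·ϑ^K`
(`omega_le_levelSum` ∘ `T4ShellMeasure.levelSum_le_geometric`). [folklore] -/
theorem omega_le (h : LevelLedger l₀ T A sh S piece lvl D ρ) {N₁ : ℕ} {νbar Dbar c₁ ϑ : ℝ}
    (hw : LiveWindow S lvl N₁ νbar) (hϑ0 : 0 < ϑ) (hϑ1 : ϑ ≤ 1) (hD : ∀ j, D j ≤ Dbar)
    (hrate : ∀ j, ρ j ≤ c₁ * ϑ ^ j) (K : ℕ) :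
    h.toSlotLedger.omega K ≤ ((N₁ + 1) * νbar * Dbar * c₁ * ϑ⁻¹ ^ N₁) * ϑ ^ K :=
  (h.omega_le_levelSum hw K).trans
    (levelSum_le_geometric (Icc (K - N₁) K) K N₁ (fun _ => νbar) D ρ hϑ0 hϑ1 hw.νbar_nonneg
      (h.const_bound_nonneg hD) (h.rate_const_nonneg hrate) (fun _ hj => le_add_of_mem_Icc_sub hj)
      (card_Icc_sub_le K N₁) (fun _ _ => le_rfl) (fun j _ => h.D_nonneg j) (fun j _ => hD j)
      (fun j _ => h.ρ_nonneg j) (fun j _ => hrate j))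

/-- weakening the constants: a level ledger with `D ≤ D'`, `ρ ≤ ρ'` pointwise (both nonnegative) is a level ledger for
`D' ρ'` (the total weights being nonnegative). [folklore] -/
theorem mono (h : LevelLedger l₀ T A sh S piece lvl D ρ) {D' ρ' : ℕ → ℝ} (hD : ∀ j, D j ≤ D' j)
    (hρ : ∀ j, ρ j ≤ ρ' j) : LevelLedger l₀ T A sh S piece lvl D' ρ' where
  sh_nonneg := h.sh_nonneg
  sh_le := h.sh_le
  cover := h.cover
  slot K t ht s hs := (h.slot K t ht s hs).trans
    (mul_le_mul_of_nonneg_right (mul_le_mul (hD _) (hρ _) (h.ρ_nonneg _) ((h.D_nonneg _).trans (hD _)))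
      (h.toSlotLedger.sum_A_nonneg K ht))
  D_nonneg j := (h.D_nonneg j).trans (hD j)
  ρ_nonneg j := (h.ρ_nonneg j).trans (hρ j)

end LevelLedger

/-! ## §2 Two level ledgers ⇒ `T4IndicatorShell.ShellWeightBound` -/

section TwoRuns

variable {ι σ σ' : Type*} {l₀ : ℝ} {T : ℕ → Finset ι} {A B shA shB : ℕ → ℝ → ι → ℝ}
  {SA : ℕ → Finset σ} {SB : ℕ → Finset σ'} {pieceA : ℕ → ℝ → σ → ι → ℝ} {pieceB : ℕ → ℝ → σ' → ι → ℝ}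
  {lvlA : ℕ → σ → ℕ} {lvlB : ℕ → σ' → ℕ} {DA ρA DB ρB : ℕ → ℝ} {N₁ : ℕ} {νbar Dbar c₁ ϑ : ℝ}

/-- **THE CONSTRUCTOR (NE7c, shell-measure route, SMOOTH members) — END TO END TO THE SOCKET DATUM.**  The two runs of
the `K`-th comparison written as LEVEL LEDGERS (each with its own levels, constants and widths), both inside a live
window of depth `N₁` with at most `ν̄` slots per level [(W1), `ν̄`], constants `≤ D̄`, widths under the (F∞)-rate
`ρ_j ≤ c₁ϑ^j`, `0 < ϑ < 1` ⇒ `T4IndicatorShell.ShellWeightBound l₀ T A B shA shB (ω^A + ω^B)` — nonnegative, summable —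
ready for `T4IndicatorShell.relWeightBound_ref` / `cauchy_of_relWeightBound_shell` and for the seam-(ζ′) socket (§3).
(= `T4ShellMeasure.shellWeightBound_of_slotLedger`, its two majorant binders discharged by `LevelLedger.omega_le`.)
CONDITIONAL on its binders; nothing PRINTED is asserted. [folklore] -/
theorem shellWeightBound_of_levels (hA : LevelLedger l₀ T A shA SA pieceA lvlA DA ρA)
    (hB : LevelLedger l₀ T B shB SB pieceB lvlB DB ρB)
    (hwA : LiveWindow SA lvlA N₁ νbar) (hwB : LiveWindow SB lvlB N₁ νbar) (hϑ0 : 0 < ϑ) (hϑ1 : ϑ < 1)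
    (hDA : ∀ j, DA j ≤ Dbar) (hDB : ∀ j, DB j ≤ Dbar)
    (hrateA : ∀ j, ρA j ≤ c₁ * ϑ ^ j) (hrateB : ∀ j, ρB j ≤ c₁ * ϑ ^ j) :
    ShellWeightBound l₀ T A B shA shB (fun K => hA.toSlotLedger.omega K + hB.toSlotLedger.omega K) :=
  shellWeightBound_of_slotLedger hA.toSlotLedger hB.toSlotLedger hϑ0.le hϑ1
    (C := (N₁ + 1) * νbar * Dbar * c₁ * ϑ⁻¹ ^ N₁) (hA.omega_le hwA hϑ0 hϑ1.le hDA hrateA)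
    (hB.omega_le hwB hϑ0 hϑ1.le hDB hrateB)

/-- the explicit bound on the NE7c shell weight: `Wsh K = ω^A K + ω^B K ≤ 2·((N₁ + 1)ν̄D̄c₁ϑ^{−N₁})·ϑ^K`. [folklore] -/
theorem omega_add_le (hA : LevelLedger l₀ T A shA SA pieceA lvlA DA ρA)
    (hB : LevelLedger l₀ T B shB SB pieceB lvlB DB ρB)
    (hwA : LiveWindow SA lvlA N₁ νbar) (hwB : LiveWindow SB lvlB N₁ νbar) (hϑ0 : 0 < ϑ) (hϑ1 : ϑ ≤ 1)
    (hDA : ∀ j, DA j ≤ Dbar) (hDB : ∀ j, DB j ≤ Dbar)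
    (hrateA : ∀ j, ρA j ≤ c₁ * ϑ ^ j) (hrateB : ∀ j, ρB j ≤ c₁ * ϑ ^ j) (K : ℕ) :
    hA.toSlotLedger.omega K + hB.toSlotLedger.omega K ≤
      (2 * ((N₁ + 1) * νbar * Dbar * c₁ * ϑ⁻¹ ^ N₁)) * ϑ ^ K := by
  have h₁ := hA.omega_le hwA hϑ0 hϑ1 hDA hrateA K
  have h₂ := hB.omega_le hwB hϑ0 hϑ1 hDB hrateB K
  linarith

/-- … hence eventually below any `ε > 0` (the smallness `Wsh K < 1 − W K` of `relWeightBound_ref`). [folklore] -/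
theorem eventually_omega_add_lt (hA : LevelLedger l₀ T A shA SA pieceA lvlA DA ρA)
    (hB : LevelLedger l₀ T B shB SB pieceB lvlB DB ρB)
    (hwA : LiveWindow SA lvlA N₁ νbar) (hwB : LiveWindow SB lvlB N₁ νbar) (hϑ0 : 0 < ϑ) (hϑ1 : ϑ < 1)
    (hDA : ∀ j, DA j ≤ Dbar) (hDB : ∀ j, DB j ≤ Dbar)
    (hrateA : ∀ j, ρA j ≤ c₁ * ϑ ^ j) (hrateB : ∀ j, ρB j ≤ c₁ * ϑ ^ j) {ε : ℝ} (hε : 0 < ε) :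
    ∀ᶠ K in Filter.atTop, hA.toSlotLedger.omega K + hB.toSlotLedger.omega K < ε :=
  eventually_lt_of_le_geometric hϑ0.le hϑ1 (omega_add_le hA hB hwA hwB hϑ0 hϑ1.le hDA hDB hrateA hrateB) hε

end TwoRuns

/-! ## §3 Through the seam-(ζ′) socket: ONE `RelWeightBound`, ONE budget — no choice-function binders -/

section Tail

variable {ι σ σ' : Type*} [DecidableEq ι] {l₀ vol : ℝ} {T : ℕ → Finset ι} {A B shA shB : ℕ → ℝ → ι → ℝ}
  {SA : ℕ → Finset σ} {SB : ℕ → Finset σ'} {pieceA : ℕ → ℝ → σ → ι → ℝ} {pieceB : ℕ → ℝ → σ' → ι → ℝ}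
  {lvlA : ℕ → σ → ℕ} {lvlB : ℕ → σ' → ℕ} {DA ρA DB ρB : ℕ → ℝ} {N₁ : ℕ} {νbar Dbar c₁ ϑ : ℝ}
  {Bad : ℕ → ℝ → Finset ι} {Cc Rr CcRec RrRec : ℕ → ℝ → ι → ℝ} {ν u s₂ c₀ r s W : ℕ → ℝ}

/-- **NE7c BY THE SMOOTH MEMBERS, THROUGH THE SEAM-(ζ′) SOCKET.**  Hypotheses: those of `shellWeightBound_of_levels`
(two level ledgers [(R) + (M1) by level], windows and counts [(W1), `ν̄`], constant bound, (F∞)-rate) PLUS the NE7b half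
`RelWeightBound … Bad W`, a `ReindexedBudget` on the hybrid cores `A − shA`, `B − shB` and four summable producer rates
`u s₂ r s` — each ONCE, for the one expansion written with the PRINTED thresholds.  Conclusion: an origin `K₀` such that
the `K₀`-shifted families carry `T4MatchingAssembly.HybridNE7` with shell weight `ω^A + ω^B` and remainder rate
`(r + u) + (s + s₂)` (= §2, then `T4MatchingClosureSocket.hybridNE7_closure'_tail`; the weight condition `W + Wsh < 1`
on the tail is free from the two structures' `summable` fields).  CONDITIONAL on its binders; nothing PRINTED is
asserted. [folklore] -/
theorem hybridNE7_tail_of_levels (hA : LevelLedger l₀ T A shA SA pieceA lvlA DA ρA)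
    (hB : LevelLedger l₀ T B shB SB pieceB lvlB DB ρB)
    (hwA : LiveWindow SA lvlA N₁ νbar) (hwB : LiveWindow SB lvlB N₁ νbar) (hϑ0 : 0 < ϑ) (hϑ1 : ϑ < 1)
    (hDA : ∀ j, DA j ≤ Dbar) (hDB : ∀ j, DB j ≤ Dbar)
    (hrateA : ∀ j, ρA j ≤ c₁ * ϑ ^ j) (hrateB : ∀ j, ρB j ≤ c₁ * ϑ ^ j)
    (hW : RelWeightBound l₀ T A B Bad W)
    (hTB : ReindexedBudget l₀ vol T (fun K t τ => A K t τ - shA K t τ) (fun K t τ => B K t τ - shB K t τ) Bad Cc Rr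
      CcRec RrRec ν u s₂ c₀ r s)
    (hr : Summable r) (hu : Summable u) (hs : Summable s) (hs₂ : Summable s₂) :
    ∃ K₀, HybridNE7 l₀ vol (fun K => T (K₀ + K)) (fun K => A (K₀ + K)) (fun K => B (K₀ + K)) (fun K => Bad (K₀ + K))
      (fun K => W (K₀ + K)) (fun K => shA (K₀ + K)) (fun K => shB (K₀ + K))
      (fun K => hA.toSlotLedger.omega (K₀ + K) + hB.toSlotLedger.omega (K₀ + K))
      (fun K => (r (K₀ + K) + u (K₀ + K)) + (s (K₀ + K) + s₂ (K₀ + K))) :=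
  hybridNE7_closure'_tail hW (shellWeightBound_of_levels hA hB hwA hwB hϑ0 hϑ1 hDA hDB hrateA hrateB) hTB hr hu hs hs₂

end Tail

section SchemeTail

open Missing T4Continuum T4Assembly

variable {G : Type*} [GaugeGroup G] [MeasurableSpace G] [HaarData G] {O : Type*}

/-- **PER STRING OF A TORUS SCHEME**: the hypotheses of `hybridNE7_tail_of_levels` for the two runs' term families read
off after `K₀ + K` resp. `K₀ + K + 1` steps through the E1/E2 dictionary `hZA hZB` of the ONE expansion with the printed
thresholds ⇒ `∃ K₁, StringHybridNE7 S os l₀ vol (K₀ + K₁)` — literally the per-string hypothesis of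
`T4MatchingClosureHosts.hasContinuumLimit_of_stringClosures` (= §2, then
`T4MatchingClosureSocket.stringHybridNE7_closure'_tail`).  CONDITIONAL on its binders. [folklore] -/
theorem stringHybridNE7_of_levels (S : TorusScheme G O) (os : List O) (K₀ : ℕ) {ι σ σ' : Type} [DecidableEq ι]
    {l₀ vol : ℝ} {T : ℕ → Finset ι} {A B shA shB : ℕ → ℝ → ι → ℝ}
    {SA : ℕ → Finset σ} {SB : ℕ → Finset σ'} {pieceA : ℕ → ℝ → σ → ι → ℝ} {pieceB : ℕ → ℝ → σ' → ι → ℝ}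
    {lvlA : ℕ → σ → ℕ} {lvlB : ℕ → σ' → ℕ} {DA ρA DB ρB : ℕ → ℝ} {N₁ : ℕ} {νbar Dbar c₁ ϑ : ℝ}
    {Bad : ℕ → ℝ → Finset ι} {Cc Rr CcRec RrRec : ℕ → ℝ → ι → ℝ} {ν u s₂ c₀ r s W : ℕ → ℝ}
    (hA : LevelLedger l₀ T A shA SA pieceA lvlA DA ρA) (hB : LevelLedger l₀ T B shB SB pieceB lvlB DB ρB)
    (hwA : LiveWindow SA lvlA N₁ νbar) (hwB : LiveWindow SB lvlB N₁ νbar) (hϑ0 : 0 < ϑ) (hϑ1 : ϑ < 1)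
    (hDA : ∀ j, DA j ≤ Dbar) (hDB : ∀ j, DB j ≤ Dbar)
    (hrateA : ∀ j, ρA j ≤ c₁ * ϑ ^ j) (hrateB : ∀ j, ρB j ≤ c₁ * ϑ ^ j)
    (hW : RelWeightBound l₀ T A B Bad W)
    (hTB : ReindexedBudget l₀ vol T (fun K t τ => A K t τ - shA K t τ) (fun K t τ => B K t τ - shB K t τ) Bad Cc Rr
      CcRec RrRec ν u s₂ c₀ r s)
    (hr : Summable r) (hu : Summable u) (hs : Summable s) (hs₂ : Summable s₂)
    (hZA : ∀ K t, |t| ≤ l₀ → T4GenFunBounds.schemeZ S os (K₀ + K) t = ∑ τ ∈ T K, A K t τ)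
    (hZB : ∀ K t, |t| ≤ l₀ → T4GenFunBounds.schemeZ S os (K₀ + K + 1) t = ∑ τ ∈ T K, B K t τ) :
    ∃ K₁, StringHybridNE7 S os l₀ vol (K₀ + K₁) :=
  stringHybridNE7_closure'_tail S os K₀ hW
    (shellWeightBound_of_levels hA hB hwA hwB hϑ0 hϑ1 hDA hDB hrateA hrateB) hTB hr hu hs hs₂ hZA hZB

end SchemeTail

/-! ## §4 The rate binder in the liaison's closed form `ρ_j = (c/θ_min)·ϑ^j` -/

/-- the closed-form width `ρ_j = c / θmin * ϑ ^ j` (the `geomWidth c θmin ϑ` of the U1b liaison `T4SupCloseLiaison`,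
not imported here) satisfies the rate field with `c₁ = c / θmin`, by `le_rfl`. [folklore] -/
theorem rate_of_geomWidth_shape (c θmin ϑ : ℝ) (j : ℕ) : c / θmin * ϑ ^ j ≤ c / θmin * ϑ ^ j := le_rfl

/-- … and is nonnegative for `0 ≤ c`, `0 ≤ θmin`, `0 ≤ ϑ` (the `ρ_nonneg` field of a level ledger written with it).
[folklore] -/
theorem geomWidth_shape_nonneg {c θmin ϑ : ℝ} (hc : 0 ≤ c) (hθ : 0 ≤ θmin) (hϑ : 0 ≤ ϑ) (j : ℕ) :
    0 ≤ c / θmin * ϑ ^ j :=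
  mul_nonneg (div_nonneg hc hθ) (pow_nonneg hϑ j)

/-- its sum: `Σ_j (c/θmin)ϑ^j = (c/θmin)(1 − ϑ)⁻¹` for `0 ≤ ϑ < 1` (the price of the window-free part). [folklore] -/
theorem tsum_geomWidth_shape (c θmin : ℝ) {ϑ : ℝ} (hϑ0 : 0 ≤ ϑ) (hϑ1 : ϑ < 1) :
    ∑' j, c / θmin * ϑ ^ j = c / θmin * (1 - ϑ)⁻¹ := by
  rw [tsum_mul_left, tsum_geometric_of_lt_one hϑ0 hϑ1]

/-! ## §5 Non-vacuity (kernel-checked, honest scope) -/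

section Sanity

/-- SANITY: a run with NO slots and ZERO shell parts is a level ledger of any nonnegative term family, for any level
map, with `D = ρ = 0`. [folklore] -/
theorem levelLedger_noSlots {ι σ : Type*} (l₀ : ℝ) (T : ℕ → Finset ι) (A : ℕ → ℝ → ι → ℝ)
    (hA : ∀ K t, |t| ≤ l₀ → ∀ τ ∈ T K, 0 ≤ A K t τ) (piece : ℕ → ℝ → σ → ι → ℝ) (lvl : ℕ → σ → ℕ) :
    LevelLedger l₀ T A (fun _ _ _ => 0) (fun _ => (∅ : Finset σ)) piece lvl (fun _ => 0) (fun _ => 0) where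
  sh_nonneg _ _ _ _ _ := le_rfl
  sh_le := hA
  cover _ _ _ _ _ := by simp
  slot _ _ _ s hs := by simp at hs
  D_nonneg _ := le_rfl
  ρ_nonneg _ := le_rfl

/-- SANITY: no slots sit in any window with count bound `0`. [folklore] -/
theorem liveWindow_noSlots {σ : Type*} (lvl : ℕ → σ → ℕ) (N₁ : ℕ) :
    LiveWindow (fun _ => (∅ : Finset σ)) lvl N₁ 0 where
  recent _ s hs := by simp at hs
  le_top _ s hs := by simp at hs
  count _ _ := by simp

-- SANITY (non-vacuity of `hybridNE7_tail_of_levels`' binder list, honest scope): one term of weight `1` per `K` in both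
-- runs, no slots, zero shell parts, `D = ρ = 0 ≤ 0 = D̄`, rate constant `c₁ = 0`, `ϑ = 1/2`, the trivial NE7b half and
-- the trivial budget on the cores `1 − 0` (`T4MatchingAssembly.hybridNE7_trivial`,
-- `T4MatchingClosureSocket.reindexedBudget_trivial_cores`), zero rates: the theorem fires (kernel-checked; all families
-- being constant in `K`, the origin shift is invisible).  Shows only that the hypotheses are jointly satisfiable; the
-- content of NE7c is in the binders.
example (l₀ vol : ℝ) :
    ∃ Wsh : ℕ → ℝ, HybridNE7 l₀ vol (fun _ => ({()} : Finset Unit)) (fun _ _ _ => 1) (fun _ _ _ => 1) (fun _ _ => ∅)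
      (fun _ => 0) (fun _ _ _ => 0) (fun _ _ _ => 0) Wsh (fun _ => ((0 : ℝ) + 0) + (0 + 0)) := by
  obtain ⟨K₀, h⟩ := hybridNE7_tail_of_levels (σ := Unit) (σ' := Unit) (vol := vol) (N₁ := 0) (νbar := 0)
    (Dbar := 0) (c₁ := 0) (ϑ := 1 / 2) (pieceA := fun _ _ _ _ => 0) (pieceB := fun _ _ _ _ => 0)
    (levelLedger_noSlots l₀ (fun _ => ({()} : Finset Unit)) (fun _ _ _ => (1 : ℝ)) (fun _ _ _ _ _ => zero_le_one) _
      (fun _ _ => 0))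
    (levelLedger_noSlots l₀ (fun _ => ({()} : Finset Unit)) (fun _ _ _ => (1 : ℝ)) (fun _ _ _ _ _ => zero_le_one) _
      (fun _ _ => 0))
    (liveWindow_noSlots _ 0) (liveWindow_noSlots _ 0) (by norm_num) (by norm_num) (fun _ => le_rfl) (fun _ => le_rfl)
    (fun _ => by simp) (fun _ => by simp) (Bad := fun _ _ => ∅) (W := fun _ => 0) (hybridNE7_trivial l₀ vol).weight
    (reindexedBudget_trivial_cores l₀ vol) summable_zero summable_zero summable_zero summable_zero
  exact ⟨_, h⟩

namespace Toy

/-! ### a one-slot toy with a genuinely level-dependent width: the top-level slot, `ρ_j = ϑ^j`, `ω K = ϑ^K` -/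

variable (ϑ : ℝ)

/-- one term `()` per step. [folklore] -/
def T : ℕ → Finset Unit := fun _ => {()}
/-- unit weight. [folklore] -/
def A : ℕ → ℝ → Unit → ℝ := fun _ _ _ => 1
/-- the shell part of the term at step `K`: `ϑ^K` (for `0 ≤ ϑ ≤ 1` this is `≤ 1 = A`). [folklore] -/
def sh : ℕ → ℝ → Unit → ℝ := fun K _ _ => ϑ ^ K
/-- one slot `()` per step. [folklore] -/
def S : ℕ → Finset Unit := fun _ => {()}
/-- the slot's piece is the whole shell part. [folklore] -/
def piece : ℕ → ℝ → Unit → Unit → ℝ := fun K _ _ _ => ϑ ^ K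
/-- the slot of step `K` sits at the top level `K`. [folklore] -/
def lvl : ℕ → Unit → ℕ := fun K _ => K
/-- constant `D = 1`. [folklore] -/
def D : ℕ → ℝ := fun _ => 1
/-- width `ρ_j = ϑ^j`. [folklore] -/
def ρ : ℕ → ℝ := fun j => ϑ ^ j

variable {ϑ}

/-- the toy is a level ledger for `0 ≤ ϑ ≤ 1`. [folklore] -/
theorem levelLedger (l₀ : ℝ) (h0 : 0 ≤ ϑ) (h1 : ϑ ≤ 1) :
    LevelLedger l₀ T (A) (sh ϑ) S (piece ϑ) lvl D (ρ ϑ) where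
  sh_nonneg K _ _ _ _ := pow_nonneg h0 K
  sh_le K _ _ _ _ := pow_le_one₀ h0 h1
  cover K _ _ _ _ := by simp [sh, S, piece]
  slot K _ _ _ _ := by simp [T, piece, D, ρ, lvl, A]
  D_nonneg _ := zero_le_one
  ρ_nonneg j := pow_nonneg h0 j

/-- its window: depth `0`, one slot per level. [folklore] -/
theorem liveWindow : LiveWindow S lvl 0 1 where
  recent _ _ _ := le_rfl
  le_top _ _ _ := le_rfl
  count K j := by
    have h : ((S K).filter fun s => lvl K s = j).card ≤ 1 :=
      (card_le_card (filter_subset _ _)).trans (by simp [S])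
    exact_mod_cast h

/-- the toy's relative shell weight is EXACTLY `ϑ^K` — level-dependent, geometric, nontrivial. [folklore] -/
theorem omega_eq (l₀ : ℝ) (h0 : 0 ≤ ϑ) (h1 : ϑ ≤ 1) (K : ℕ) :
    (levelLedger l₀ h0 h1).toSlotLedger.omega K = ϑ ^ K := by
  rw [(levelLedger l₀ h0 h1).omega_eq]
  simp [S, D, ρ, lvl]

/-- §1's bound on the toy reads `ϑ^K ≤ (1·1·1·1·1)·ϑ^K`: attained (window depth `0`). [folklore] -/
theorem omega_le_attained (l₀ : ℝ) (h0 : 0 < ϑ) (h1 : ϑ ≤ 1) (K : ℕ) :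
    (levelLedger l₀ h0.le h1).toSlotLedger.omega K ≤ ((((0 : ℕ) : ℝ) + 1) * 1 * 1 * 1 * ϑ⁻¹ ^ 0) * ϑ ^ K :=
  (levelLedger l₀ h0.le h1).omega_le (N₁ := 0) (νbar := 1) (Dbar := 1) (c₁ := 1) liveWindow h0 h1
    (fun _ => le_rfl) (fun j => show ϑ ^ j ≤ 1 * ϑ ^ j from (one_mul _).symm.le) K

example (l₀ : ℝ) (h0 : 0 < ϑ) (h1 : ϑ ≤ 1) (K : ℕ) :
    ((((0 : ℕ) : ℝ) + 1) * 1 * 1 * 1 * ϑ⁻¹ ^ 0) * ϑ ^ K = (levelLedger l₀ h0.le h1).toSlotLedger.omega K := by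
  rw [omega_eq l₀ h0.le h1]; push_cast; ring

/-- two copies of the toy give the NE7c socket datum with `Wsh K = 2ϑ^K` (`0 < ϑ < 1`). [folklore] -/
theorem shellWeightBound (l₀ : ℝ) (h0 : 0 < ϑ) (h1 : ϑ < 1) :
    ShellWeightBound l₀ T A A (sh ϑ) (sh ϑ)
      (fun K => (levelLedger l₀ h0.le h1.le).toSlotLedger.omega K +
        (levelLedger l₀ h0.le h1.le).toSlotLedger.omega K) :=
  shellWeightBound_of_levels (N₁ := 0) (νbar := 1) (Dbar := 1) (c₁ := 1) (levelLedger l₀ h0.le h1.le)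
    (levelLedger l₀ h0.le h1.le) liveWindow liveWindow h0 h1 (fun _ => le_rfl) (fun _ => le_rfl)
    (fun j => show ϑ ^ j ≤ 1 * ϑ ^ j from (one_mul _).symm.le)
    (fun j => show ϑ ^ j ≤ 1 * ϑ ^ j from (one_mul _).symm.le)

example (l₀ : ℝ) (h0 : 0 < ϑ) (h1 : ϑ < 1) (K : ℕ) :
    (levelLedger l₀ h0.le h1.le).toSlotLedger.omega K + (levelLedger l₀ h0.le h1.le).toSlotLedger.omega K =
      2 * ϑ ^ K := by
  rw [omega_eq l₀ h0.le h1.le]; ring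

end Toy

end Sanity

end Literature.MathematicalPhysics.QuantumFieldTheory.Balaban1983to89.T4ShellMeasureLevels
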